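import Summits.Schanuel.Schanuel.Theorems.RootDecomp1KIntegrality02

/-!
# RootDecomp1KIntegrality — lens 1, generation 55, NODE 15 «ODD-PLACE INTEGRALITY (Gauss on the level polynomial)» (RULE K-R45 payable clause; K-R46) — continuation (RootDecomp1KIntegrality03): §6 the members RC2 and GC2

(lens-1 g55 NODE 15 HOME kernel K = HOME/decomp-schanuel-lens-1/g55/Integrality.lean 64be435d…, 1006 l, 116 thm + 1 lemma + 10 def, imports tree …RootDecomp1KLocalExponent06 ONLY (no Literature import); Probe / Ctrl0 / Ctrl + NODE-g55.md + SHA256SUMS; CLAIM L2635, crit EX-ANTE PRICE L2637 (ONE THEOREM ×1 under K-R45's payable clause «an infinite class of FRONTIER pairs made unconditional, any input» iff CHECKLIST K-g55; anti-salami: the one credit covers the integrality lever at BOTH ends of the level polynomial; RULE K-R46 pre-announced), census LIVENESS-v5 (GaussAt column) L2636 / crit L2639, NODE L2640 / REQUEST L2641, census STAGING NOTE 5 L2643, critic VERDICT L2642: CLEARED — THEOREM ×1 under K-R45 payable clause (EX-ANTE PRICE L2637), CHECKLIST K-g55 met; RULE K-R46 FIXED (toolkit of record ∪ Gauss divisibility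 on levelPoly; amended FRONTIER; tabled conditional-only members at 2 = M17P, L17P); PORT GO (verbatim; docstrings/provenance only; the dedup deletions announced L2643). Port by census-1 gen 22 as `RootDecomp1KIntegrality01–04` (`--supports stmt-Schanuel-33364`; no census credit): 01 = §1 the level polynomial `levelPoly` over ℤ and GAUSS AT THE ODD PLACES — `DomZero`, `leadingCoeff_levelPoly`, **`den_dvd_of_level`** (den r ∣ lc(c₀)·2^(v₂ den r)), `den_le_of_level` + §2 bounded height: `finite_rat_of_abs_le_den_le`, `levels_finite_of_bounded`; 02 = §3 ENGINE `thinFibreAt_of_dom_farClause` / `thinFibreAt_of_dom_slopeCond` (node 14's engine with the root condition DELETED) + §4 the class **`GaussAt m₀ P`** (intrinsic: P ≠ 0 ∧ deg_Y c₀ > deg_Y c_j (1 ≤ j ≤ xdeg P) ∧ SlopeCond) and THE THEOREM **`thinFibreAt_of_gaussAt : GaussAt m₀ P → ThinFibreAt m₀ P`** (every m₀), `gaussAt_xPolyP_iff`, `gaussAt_mono` + §5 the frontier-certified member **`thinFibreAt_H17P_all : 1 ≤ m₀ → ThinFibreAt m₀ H17P` HYPOTHESIS-FREE** (node 12's HeightComparison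 binder removed; `gaussAt_H17P`, `not_localAt_H17P`); 03 = §6 the members `RC2` = x²(Y−1)² + x(Y³−2) + Y⁵ (rational DOUBLE centre) and `GC2` = x²(Y²−17) + x(Y³+Y+1) + (Y⁴+Y³−2) (irrational simple ℚ₂-centres) at m₀ = 2 hyp-free, with their costume tests; 04 = §7 the infinite family `H17D D` + §8 position of the class (`not_gaussAt_L13`, `not_gaussAt_M17P`, …) + §9 bookkeeping ×0 (`GaussOffAt`). PORT EDITS: TWO dedup.landed twins DELETED for the tree decls (head dry-run): K's `finite_rat_of_abs_le_den_le` (≡ `RootDecomp1KLevelFinite.finite_rat_of_abs_le_den_le`, LevelFinite03 — same short name, resolved through K's own `open …LevelFinite`) and K's `partialSum_two_eq` (≡ `RootDecomp1KLevelFinite.lac_partialSum_two`, LevelFinite12 — the one use re-pointed by name); 36 one-line docstrings on undocumented computation lemmas of §6–§7 (statements quoted); otherwise none (K has no private / set_option / cite-token); provenance doc blocks + continuation headers = K's own open-lines; statements and proofs VERBATIM. Rung 0 — nothing here proves Schanuel, 33364, 33363, 31077 or ThinFibre 2; the class and members are HYPOTHESIS-FREE, §9 conditional on PadicSubspace / 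HeightComparison.)
-/

noncomputable section

namespace Summit.Schanuel.Schanuel.Theorems.RootDecomp1KIntegrality

open Polynomial LiouvilleNumber
open scoped Nat
open Summit.Schanuel.Schanuel.Theorems.RootDecomp1KTwoBaseCell (psNumer partialSum_eq_psNumer_div coprime_psNumer)
open Summit.Schanuel.Schanuel.Theorems.RootDecomp1KRelLiouvilleCell (partialSum_two_strictMono)
open Summit.Schanuel.Schanuel.Theorems.RootDecomp1KDegreeLadder
open Summit.Schanuel.Schanuel.Theorems.RootDecomp1KXLinear
open Summit.Schanuel.Schanuel.Theorems.RootDecomp1KXTop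
open Summit.Schanuel.Schanuel.Theorems.RootDecomp1KXAll
open Summit.Schanuel.Schanuel.Theorems.RootDecomp1KLevelFinite
open Summit.Schanuel.Schanuel.Theorems.RootDecomp1KSubspaceBranch
open Summit.Schanuel.Schanuel.Theorems.RootDecomp1KHeightGrading
open Summit.Schanuel.Schanuel.Theorems.RootDecomp1KHeightMachine
open Summit.Schanuel.Schanuel.Theorems.RootDecomp1KLocalExponent

/-! ## §6  TWO NEW MEMBERS at `m₀ = 2`: a RATIONAL DOUBLE centre (`RC2`) and an IRRATIONAL SIMPLE `ℚ₂`-centre (`GC2`) -/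

/-- the `x`-coefficients of `RC2 := x²(Y − 1)² + x(Y³ − 2) + Y⁵`. -/
def rc2C : ℕ → ℤ[X]
  | 0 => X ^ 5
  | 1 => X ^ 3 - C 2
  | _ => (X - C 1) ^ 2

/-- **`RC2 = x²(Y − 1)² + x(Y³ − 2) + Y⁵`**: top `(Y − 1)²` — a RATIONAL DOUBLE centre `1 ∈ ℚ` (Liouville-critical at
`m₀ = 2 = μ`: node 14's branch (ii) needs `μ + 1 = 3`). -/
def RC2 : ℤ[X][X] := xPolyP 2 rc2C

/-- the `x`-coefficients of `GC2 := x²(Y² − 17) + x(Y³ + Y + 1) + (Y⁴ + Y³ − 2)` (`= M17P + Y⁴`). -/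
def gc2C : ℕ → ℤ[X]
  | 0 => X ^ 4 + X ^ 3 - C 2
  | 1 => X ^ 3 + X + C 1
  | _ => X ^ 2 - C 17

/-- **`GC2 = x²(Y² − 17) + x(Y³ + Y + 1) + (Y⁴ + Y³ − 2)`**: top `Y² − 17` — IRRATIONAL SIMPLE centres `±√17 ∈ ℚ₂`
(Ridout-critical at `m₀ = 2 = 2μ`: node 14's branch (iii) needs `3`; node 11's class needs `eTop + 1 = 3`). -/
def GC2 : ℤ[X][X] := xPolyP 2 gc2C

/-- `rc2C 0 = X ^ 5`. -/
theorem rc2C_zero : rc2C 0 = X ^ 5 := rfl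
/-- `rc2C 1 = X ^ 3 - C 2`. -/
theorem rc2C_one : rc2C 1 = X ^ 3 - C 2 := rfl
/-- `rc2C 2 = (X - C 1) ^ 2`. -/
theorem rc2C_two : rc2C 2 = (X - C 1) ^ 2 := rfl
/-- `gc2C 0 = X ^ 4 + X ^ 3 - C 2`. -/
theorem gc2C_zero : gc2C 0 = X ^ 4 + X ^ 3 - C 2 := rfl
/-- `gc2C 1 = X ^ 3 + X + C 1`. -/
theorem gc2C_one : gc2C 1 = X ^ 3 + X + C 1 := rfl
/-- `gc2C 2 = m17C 2`. -/
theorem gc2C_two : gc2C 2 = m17C 2 := by rw [m17C_two]; rfl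

/-- `(rc2C 0).natDegree = 5`. -/
theorem natDegree_rc2C_zero : (rc2C 0).natDegree = 5 := by rw [rc2C_zero, natDegree_X_pow]
/-- `(rc2C 1).natDegree = 3`. -/
theorem natDegree_rc2C_one : (rc2C 1).natDegree = 3 := by rw [rc2C_one, natDegree_X_pow_sub_C]
/-- `(rc2C 2).natDegree = 2`. -/
theorem natDegree_rc2C_two : (rc2C 2).natDegree = 2 := by rw [rc2C_two, natDegree_pow, natDegree_X_sub_C]
/-- `(gc2C 0).natDegree = 4`. -/
theorem natDegree_gc2C_zero : (gc2C 0).natDegree = 4 := by rw [gc2C_zero]; compute_degree!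
/-- `(gc2C 1).natDegree = 3`. -/
theorem natDegree_gc2C_one : (gc2C 1).natDegree = 3 := by rw [gc2C_one]; compute_degree!
/-- `(gc2C 2).natDegree = 2`. -/
theorem natDegree_gc2C_two : (gc2C 2).natDegree = 2 := by rw [gc2C_two, natDegree_m17C_two]
/-- `rc2C 2 ≠ 0`. -/
theorem rc2C_two_ne_zero : rc2C 2 ≠ 0 := fun h => by
  have := natDegree_rc2C_two; rw [h, natDegree_zero] at this; exact absurd this (by norm_num)
/-- `gc2C 2 ≠ 0`. -/
theorem gc2C_two_ne_zero : gc2C 2 ≠ 0 := fun h => by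
  have := natDegree_gc2C_two; rw [h, natDegree_zero] at this; exact absurd this (by norm_num)

/-- `DomZero 2 rc2C`. -/
theorem domZero_rc2C : DomZero 2 rc2C := by
  intro j hj1 hj2
  rw [natDegree_rc2C_zero]
  interval_cases j
  · rw [natDegree_rc2C_one]; norm_num
  · rw [natDegree_rc2C_two]; norm_num

/-- `DomZero 2 gc2C`. -/
theorem domZero_gc2C : DomZero 2 gc2C := by
  intro j hj1 hj2
  rw [natDegree_gc2C_zero]
  interval_cases j
  · rw [natDegree_gc2C_one]; norm_num
  · rw [natDegree_gc2C_two]; norm_num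

/-- slopes of `RC2` at `m₀ ≥ 2`: `5 − 2 = 3 < 2·m₀`, `3 − 2 = 1 < m₀`. -/
theorem slopeCond_rc2C {m₀ : ℕ} (hm : 2 ≤ m₀) : SlopeCond m₀ 2 rc2C := by
  intro j hj hdj
  rw [natDegree_rc2C_two] at hdj ⊢
  interval_cases j
  · rw [natDegree_rc2C_zero]; omega
  · rw [natDegree_rc2C_one]; omega

/-- slopes of `GC2` at `m₀ ≥ 2`: `4 − 2 = 2 < 2·m₀`, `3 − 2 = 1 < m₀`. -/
theorem slopeCond_gc2C {m₀ : ℕ} (hm : 2 ≤ m₀) : SlopeCond m₀ 2 gc2C := by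
  intro j hj hdj
  rw [natDegree_gc2C_two] at hdj ⊢
  interval_cases j
  · rw [natDegree_gc2C_zero]; omega
  · rw [natDegree_gc2C_one]; omega

/-- `RC2 ∈ GaussAt m₀` for `m₀ ≥ 2`. -/
theorem gaussAt_RC2 {m₀ : ℕ} (hm : 2 ≤ m₀) : GaussAt m₀ RC2 :=
  gaussAt_xPolyP 2 rc2C rc2C_two_ne_zero domZero_rc2C (slopeCond_rc2C hm)

/-- `GC2 ∈ GaussAt m₀` for `m₀ ≥ 2`. -/
theorem gaussAt_GC2 {m₀ : ℕ} (hm : 2 ≤ m₀) : GaussAt m₀ GC2 :=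
  gaussAt_xPolyP 2 gc2C gc2C_two_ne_zero domZero_gc2C (slopeCond_gc2C hm)

/-- **`ThinFibreAt 2 RC2`** — no hypothesis (a rational DOUBLE `2`-adic centre decided at the Liouville-critical `m₀`). -/
theorem thinFibreAt_two_RC2 : ThinFibreAt 2 RC2 := thinFibreAt_of_gaussAt (gaussAt_RC2 le_rfl)

/-- **`ThinFibreAt 2 GC2`** — no hypothesis (an irrational SIMPLE `ℚ₂`-centre decided at the Ridout-critical `m₀`). -/
theorem thinFibreAt_two_GC2 : ThinFibreAt 2 GC2 := thinFibreAt_of_gaussAt (gaussAt_GC2 le_rfl)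

/-- `RC2` at `m₀ = 1` is NOT claimed (slope `3 < 2` fails). -/
theorem not_gaussAt_one_RC2 : ¬ GaussAt 1 RC2 := by
  intro h
  have := ((gaussAt_xPolyP_iff 2 rc2C rc2C_two_ne_zero).mp h).2 0 (by norm_num)
    (by rw [natDegree_rc2C_zero, natDegree_rc2C_two]; norm_num)
  rw [natDegree_rc2C_zero, natDegree_rc2C_two] at this
  omega

/-- `xdeg RC2 = 2`. -/
theorem xdeg_RC2 : xdeg RC2 = 2 := xdeg_xPolyP 2 rc2C rc2C_two_ne_zero
/-- `xdeg GC2 = 2`. -/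
theorem xdeg_GC2 : xdeg GC2 = 2 := xdeg_xPolyP 2 gc2C gc2C_two_ne_zero
/-- `topX RC2 = (X - C 1) ^ 2`. -/
theorem topX_RC2 : topX RC2 = (X - C 1) ^ 2 := topX_xPolyP 2 rc2C rc2C_two_ne_zero
/-- `topX GC2 = m17C 2`. -/
theorem topX_GC2 : topX GC2 = m17C 2 := (topX_xPolyP 2 gc2C gc2C_two_ne_zero).trans gc2C_two
/-- `RC2.natDegree = 5`. -/
theorem natDegree_RC2 : RC2.natDegree = 5 :=
  (natDegree_xPolyP_of_domZero 2 rc2C domZero_rc2C).trans natDegree_rc2C_zero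
/-- `GC2.natDegree = 4`. -/
theorem natDegree_GC2 : GC2.natDegree = 4 :=
  (natDegree_xPolyP_of_domZero 2 gc2C domZero_gc2C).trans natDegree_gc2C_zero
/-- `RC2 ≠ 0`. -/
theorem RC2_ne_zero : RC2 ≠ 0 := xPolyP_ne_zero rc2C_two_ne_zero
/-- `GC2 ≠ 0`. -/
theorem GC2_ne_zero : GC2 ≠ 0 := xPolyP_ne_zero gc2C_two_ne_zero
/-- `eTop RC2 = 3`. -/
theorem eTop_RC2 : eTop RC2 = 3 := by unfold eTop; rw [topX_RC2, natDegree_RC2, natDegree_pow, natDegree_X_sub_C]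
/-- `eTop GC2 = 2`. -/
theorem eTop_GC2 : eTop GC2 = 2 := by unfold eTop; rw [topX_GC2, natDegree_GC2, natDegree_m17C_two]

/-- **`RC2 ∉ LocalAt 2`** (node 14): the top `(Y − 1)²` is REFUSED by the root condition at `2` (tree `not_rootCond_two_sq`). -/
theorem not_localAt_two_RC2 : ¬ LocalAt 2 RC2 := fun h => by
  have hR := rootCond_topX_of_localAt h
  rw [topX_RC2] at hR
  exact not_rootCond_two_sq hR

/-- (honesty) `RC2 ∈ LocalAt 3`: at `m₀ ≥ 3` the member was already decided by node 14 (tree `rootCond_three_sq`). -/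
theorem localAt_three_RC2 : LocalAt 3 RC2 :=
  ⟨2, rc2C, rc2C_two_ne_zero, rfl, rootCond_three_sq, slopeCond_rc2C (by norm_num)⟩

/-- the top `Y² − 17` is REFUSED by node 14's root condition at `m₀ ≤ 2`: its root `√17 ∈ ℚ₂` is IRRATIONAL and
SIMPLE — (i) fails, (ii) fails, (iii) needs `3 ≤ m₀` (the `M17P` pattern, tree `not_localAt_two_M17P`). -/
theorem not_rootCond_m17C_two {m₀ : ℕ} (hm : m₀ ≤ 2) : ¬ RootCond m₀ (m17C 2) := by
  intro hR
  obtain ⟨z, hz⟩ := exists_padic_root_m17C_two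
  have hβroot : aeval (algebraMap ℚ_[2] (PadicAlgCl 2) z) (m17C 2) = 0 := by
    rw [← algebraMap_aeval_padic, hz, map_zero]
  rcases hR _ hβroot with hi | ⟨q, hq, -⟩ | hiii
  · exact hi z rfl
  · have hq2 : (q : PadicAlgCl 2) ^ 2 = 17 := by
      have := hβroot
      rw [← hq, m17C_two, map_sub, map_pow, aeval_X, aeval_C, sub_eq_zero] at this
      rw [this, eq_intCast, Int.cast_ofNat]
    have hq2' : (q : ℝ) ^ 2 = 17 := by
      have h' : q ^ 2 = 17 := by exact_mod_cast hq2
      exact_mod_cast congrArg (fun t : ℚ => (t : ℝ)) h'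
    have hirr : Irrational (Real.sqrt (17 : ℝ)) := by
      simpa using Nat.Prime.irrational_sqrt (by norm_num : Nat.Prime 17)
    refine hirr.ne_rat |q| ?_
    rw [Rat.cast_abs, ← Real.sqrt_sq_eq_abs, hq2']
  · have hm2 : m17C 2 ≠ 0 := fun h0 => by have := natDegree_m17C_two; rw [h0, natDegree_zero] at this; omega
    have hm0 : (m17C 2).map (algebraMap ℤ (PadicAlgCl 2)) ≠ 0 :=
      (Polynomial.map_ne_zero_iff (algebraMap ℤ (PadicAlgCl 2)).injective_int).mpr hm2
    have h1 : 0 < rootMult (m17C 2) (algebraMap ℚ_[2] (PadicAlgCl 2) z) := by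
      unfold rootMult
      rw [rootMultiplicity_pos hm0, IsRoot.def, eval_map_algebraMap]
      exact hβroot
    omega

/-- **`GC2 ∉ LocalAt 2`.** -/
theorem not_localAt_two_GC2 : ¬ LocalAt 2 GC2 := fun h => by
  have hR := rootCond_topX_of_localAt h
  rw [topX_GC2] at hR
  exact not_rootCond_m17C_two le_rfl hR

/-- (honesty) `GC2 ∈ LocalAt 3` (branch (iii) at `2μ + 1 = 3`; the tree's Ridout window) — new only at `m₀ = 2`. -/
theorem localAt_three_GC2 : LocalAt 3 GC2 := by
  refine ⟨2, gc2C, gc2C_two_ne_zero, rfl, fun β hβ => Or.inr (Or.inr ?_), slopeCond_gc2C (by norm_num)⟩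
  rw [gc2C_two] at hβ ⊢
  have := rootMultiplicity_le_one_of_separable (m17C 2) separable_m17C_two β
  unfold rootMult
  omega

/-- `RC2 ∉ SepTopAt m₀` at ANY `m₀` (its top `(Y − 1)²` is not separable). -/
theorem not_sepTopAt_RC2 (m₀ : ℕ) : ¬ SepTopAt m₀ RC2 := by
  intro h
  have hsep := h.1
  rw [topX_RC2, Polynomial.map_pow] at hsep
  have hnu : ¬ IsUnit ((X - C 1 : ℤ[X]).map (Int.castRingHom ℚ)) := by
    intro hu
    have h0 := natDegree_eq_zero_of_isUnit hu
    rw [Polynomial.map_sub, map_X, map_C, natDegree_X_sub_C] at h0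
    exact one_ne_zero h0
  have := (hsep.of_pow hnu two_ne_zero).2
  norm_num at this

/-- `GC2 ∉ SepTopAt 2` (node 11's class needs `eTop + 1 = 3 ≤ m₀`). -/
theorem not_sepTopAt_two_GC2 : ¬ SepTopAt 2 GC2 := fun h => by
  have := h.2; rw [eTop_GC2] at this; omega

/-- (honesty) `GC2 ∈ SepTopAt 3` (conditional class of node 11). -/
theorem sepTopAt_three_GC2 : SepTopAt 3 GC2 :=
  ⟨by rw [topX_GC2]; exact separable_m17C_two, le_of_eq (by rw [eTop_GC2])⟩

/-- `RC2` is not affine in `x` (position). -/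
theorem RC2_not_affine : bev RC2 0 0 + bev RC2 2 0 ≠ 2 * bev RC2 1 0 := by
  simp only [RC2, bev_xPolyP, Finset.sum_range_succ, Finset.sum_range_zero, rc2C, map_sub, map_pow, aeval_X,
    eq_intCast, map_ofNat]
  norm_num

/-- `GC2` is not affine in `x` (position). -/
theorem GC2_not_affine : bev GC2 0 0 + bev GC2 2 0 ≠ 2 * bev GC2 1 0 := by
  simp only [GC2, bev_xPolyP, Finset.sum_range_succ, Finset.sum_range_zero, gc2C, map_sub, map_add, map_pow,
    aeval_X, eq_intCast, map_ofNat]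
  norm_num

/-- `RC2` is not `x`-linear. -/
theorem RC2_ne_xLinP (A B : ℤ[X]) : RC2 ≠ xLinP A B := fun h => by
  have := RC2_not_affine; rw [h] at this; exact this (xLinP_affine A B 0)

/-- `GC2` is not `x`-linear. -/
theorem GC2_ne_xLinP (A B : ℤ[X]) : GC2 ≠ xLinP A B := fun h => by
  have := GC2_not_affine; rw [h] at this; exact this (xLinP_affine A B 0)

/-- `RC2` is not a two-term curve (`x¹Y⁰` and `x²Y⁰` both occur). -/
theorem RC2_ne_twoTermP (k : ℕ) (B A : ℤ[X]) : RC2 ≠ twoTermP k B A := by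
  intro h
  have h1 := congrArg (fun Q : ℤ[X][X] => (Q.coeff 0).coeff 1) h
  have h2 := congrArg (fun Q : ℤ[X][X] => (Q.coeff 0).coeff 2) h
  have e1 : (rc2C 1).coeff 0 = -2 := by
    rw [rc2C_one, coeff_sub, coeff_X_pow, coeff_C]; norm_num
  have e2 : (rc2C 2).coeff 0 = 1 := by
    rw [rc2C_two, coeff_zero_eq_eval_zero]; simp
  simp only [RC2, coeff_coeff_xPolyP, coeff_coeff_twoTermP, Finset.mem_range, e1, e2] at h1 h2
  split_ifs at h1 h2 <;> omega

/-- `GC2` is not a two-term curve (`x¹Y⁰` and `x²Y⁰` both occur). -/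
theorem GC2_ne_twoTermP (k : ℕ) (B A : ℤ[X]) : GC2 ≠ twoTermP k B A := by
  intro h
  have h1 := congrArg (fun Q : ℤ[X][X] => (Q.coeff 0).coeff 1) h
  have h2 := congrArg (fun Q : ℤ[X][X] => (Q.coeff 0).coeff 2) h
  have e1 : (gc2C 1).coeff 0 = 1 := by
    rw [gc2C_one, coeff_zero_eq_eval_zero]; simp
  have e2 : (gc2C 2).coeff 0 = -17 := by
    rw [gc2C_two, m17C_two, coeff_zero_eq_eval_zero]; simp
  simp only [GC2, coeff_coeff_xPolyP, coeff_coeff_twoTermP, Finset.mem_range, e1, e2] at h1 h2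
  split_ifs at h1 h2 <;> omega

/-- in every presentation of `RC2` the top has the root `1 ∈ ℚ₂`: NOT `RootlessTop e`. -/
theorem not_rootlessTop_RC2 (e : ℕ) : ¬ RootlessTop e RC2 := by
  rintro ⟨k', c', -, hroot, hP⟩
  rcases top_cases_of_eq 2 rc2C rc2C_two_ne_zero k' c' hP with h | h
  · exact hroot 1 (by rw [h, rc2C_two]; simp)
  · exact hroot 0 (by rw [h, map_zero])

/-- in every presentation of `GC2` the top has the root `√17 ∈ ℚ₂`: NOT `RootlessTop e`. -/
theorem not_rootlessTop_GC2 (e : ℕ) : ¬ RootlessTop e GC2 := by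
  rintro ⟨k', c', -, hroot, hP⟩
  rcases top_cases_of_eq 2 gc2C gc2C_two_ne_zero k' c' hP with h | h
  · obtain ⟨z, hz⟩ := exists_padic_root_m17C_two
    exact hroot z (by rw [h, gc2C_two, hz])
  · exact hroot 0 (by rw [h, map_zero])

/-- **`RC2` is in NO class decided by the tree at `m₀ = 2`.** -/
theorem not_decidedAt_two_RC2 : ¬ DecidedAt 2 RC2 := by
  rintro (h | ⟨A, B, -, -, hP⟩ | ⟨h3, -⟩ | h | h)
  · rw [natDegree_RC2] at h; omega
  · exact RC2_ne_xLinP A B hP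
  · omega
  · have := three_le_thinThreshold RC2; omega
  · exact not_rootlessTop_RC2 1 h

/-- **`GC2` is in NO class decided by the tree at `m₀ = 2`.** -/
theorem not_decidedAt_two_GC2 : ¬ DecidedAt 2 GC2 := by
  rintro (h | ⟨A, B, -, -, hP⟩ | ⟨h3, -⟩ | h | h)
  · rw [natDegree_GC2] at h; omega
  · exact GC2_ne_xLinP A B hP
  · omega
  · have := three_le_thinThreshold GC2; omega
  · exact not_rootlessTop_GC2 1 h

/-- **COSTUME TESTS, summarised**: both new members lie in the open territory of record after node 14 at `m₀ = 2`
and ARE decided at `2` by THE THEOREM, hypothesis-free. -/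
theorem RC2_territory : ¬ DecidedAt 2 RC2 ∧ ¬ SepTopAt 2 RC2 ∧ ¬ LocalAt 2 RC2 ∧ ThinFibreAt 2 RC2 :=
  ⟨not_decidedAt_two_RC2, not_sepTopAt_RC2 2, not_localAt_two_RC2, thinFibreAt_two_RC2⟩

/-- `¬ DecidedAt 2 GC2 ∧ ¬ SepTopAt 2 GC2 ∧ ¬ LocalAt 2 GC2 ∧ ThinFibreAt 2 GC2`. -/
theorem GC2_territory : ¬ DecidedAt 2 GC2 ∧ ¬ SepTopAt 2 GC2 ∧ ¬ LocalAt 2 GC2 ∧ ThinFibreAt 2 GC2 :=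
  ⟨not_decidedAt_two_GC2, not_sepTopAt_two_GC2, not_localAt_two_GC2, thinFibreAt_two_GC2⟩

end Summit.Schanuel.Schanuel.Theorems.RootDecomp1KIntegrality

end
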